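import Summits.ABC.ABC.Theses.RationalCuspPencil
import Literature.NumberTheory.EllipticCurves.IntegralModelMinimalScalingProofs
import Literature.NumberTheory.EllipticCurves.SzpiroFreyProofs
import Literature.NumberTheory.DiophantineGeometry.MinimalDiscriminantFactorizationProofs
import Literature.NumberTheory.DiophantineGeometry.ConductorFactorizationProofs
import HarnessLib

/-!
# The six-torsion dictionary: Tate's algorithm away from `6` on Kubert's model `W(u, w)`

`Summits/ABC/ABC/Theorems/RationalCuspPencilSixTorsionDictionary.lean` — closes the support item
stmt-ABC-24551 `Summit.ABC.ABC.Theses.RationalCuspPencil.SixTorsionDictionary` of route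
`RationalCuspPencil` (abc-idea-1 g4), on the pattern of
`Summit.ABC.ABC.Theorems.twoTorsionDictionary_proof` (file `TwoTorsionDictionary.lean`; the two
generic steps `Δ_min ∣ Δ(W₀)` and "radical divides once every prime does" are inlined here rather
than imported from that file, which imports two route files — the theses-cone lint asks for
route-independent imports).

**Statement.** For coprime integers `u, w` with `u w (u+w)(9u+w) ≠ 0` and every elliptic
`W = ⟨w−u, −u(u+w), −uw(u+w), 0, 0⟩ / ℚ` (Kubert's Tate normal form of a curve with a rational
point of order six):

* `|Δ_min(W)| ≤ |u⁶ w² (u+w)³ (9u+w)|` — the right-hand side is `|Δ|` of the integral equation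
  (`Δ_eq`, an identity of polynomials), and `Δ_min` divides the discriminant of any integral
  equation [Silverman AEC VII.1 Remark 1.1];
* `rad(u w (u+w)(9u+w)) ∣ 6 · N_W` — at a prime `p ≥ 5` dividing one of the four cusp forms the
  integral equation has `p ∤ c₄` (`c₄ = 9u⁴+12u³w+30u²w²+12uw³+w⁴ ≡ w⁴, 9u⁴, 16u⁴, 144u⁴` modulo
  `u, w, u+w, 9u+w` respectively, and `gcd(u, w) = 1`), hence is minimal at `p` with multiplicative
  reduction, `f_p = 1`, `p ∣ N_W` (Tate's algorithm, Silverman AEC VII.5.1(b); tree: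
  `WeierstrassCurve.conductorExponent_eq_one_of_dvd_Δ_of_not_dvd_c₄`); the primes `2, 3` are
  absorbed by the factor `6`.

HONESTY. Local bookkeeping on the ℤ/6-torsion class (instrument DESK-PENCIL-6, kit j297089: 0
failures on 14 404 pairs — computed ≠ proved; this file is the proof). It moves no rung of
LADDER-ABC; the class ε-shape it serves is NOT abc, NOT A-PS (polynomial Szpiro), NOT A1′.

References: [SilvermanAEC2009] VII.1 Remark 1.1, VII.5 Prop. 5.1(b); [Kubert1976] Table 3.
-/

set_option linter.dupNamespace false

namespace Summit.ABC.ABC.Theorems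

open IsDedekindDomain WeierstrassCurve Rat.HeightOneSpectrum UniqueFactorizationMonoid
open Literature.NumberTheory.EllipticCurves Literature.NumberTheory.DiophantineGeometry

namespace SixTorsionDictionary

/-! ### The integral Kubert equation `⟨w−u, −u(u+w), −uw(u+w), 0, 0⟩ / ℤ` -/

/-- `c₄ = 9u⁴ + 12u³w + 30u²w² + 12uw³ + w⁴` for Kubert's ℤ/6 model. [cite: Kubert1976, Table 3] -/
theorem c₄_eq (u w : ℤ) :
    (⟨w - u, -(u * (u + w)), -(u * w * (u + w)), 0, 0⟩ : WeierstrassCurve ℤ).c₄ =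
      9 * u ^ 4 + 12 * u ^ 3 * w + 30 * u ^ 2 * w ^ 2 + 12 * u * w ^ 3 + w ^ 4 := by
  simp only [WeierstrassCurve.c₄, WeierstrassCurve.b₂, WeierstrassCurve.b₄]
  ring

/-- `Δ = u⁶ w² (u+w)³ (9u+w)` for Kubert's ℤ/6 model (dictionary item (D1); PARI check job
j296255 / DESK-PENCIL-6 P1). [cite: Kubert1976, Table 3] -/
theorem Δ_eq (u w : ℤ) :
    (⟨w - u, -(u * (u + w)), -(u * w * (u + w)), 0, 0⟩ : WeierstrassCurve ℤ).Δ =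
      u ^ 6 * w ^ 2 * (u + w) ^ 3 * (9 * u + w) := by
  simp only [WeierstrassCurve.Δ, WeierstrassCurve.b₂, WeierstrassCurve.b₄, WeierstrassCurve.b₆,
    WeierstrassCurve.b₈]
  ring

/-- The integral Kubert equation base-changed to `ℚ` is the route's `W(u, w) / ℚ`. [folklore] -/
theorem baseChange_eq (u w : ℤ) :
    (⟨w - u, -(u * (u + w)), -(u * w * (u + w)), 0, 0⟩ : WeierstrassCurve ℤ).baseChange ℚ =
      ⟨((w - u : ℤ) : ℚ), ((-(u * (u + w)) : ℤ) : ℚ), ((-(u * w * (u + w)) : ℤ) : ℚ), 0, 0⟩ := by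
  ext <;> simp [WeierstrassCurve.baseChange, WeierstrassCurve.map]

/-! ### Primes `p ≥ 5` of the four cusp forms do not divide `c₄` -/

/-- A prime `p ≥ 5` does not divide `144 = 2⁴·3²`. [folklore] -/
theorem not_dvd_144 {p : ℕ} (hp : p.Prime) (h5 : 5 ≤ p) : ¬ (p : ℤ) ∣ 144 := by
  intro h
  have h' : p ∣ 2 ^ 4 * 3 ^ 2 := by exact_mod_cast h
  rcases (Nat.Prime.dvd_mul hp).mp h' with h2 | h3
  · have := (Nat.prime_dvd_prime_iff_eq hp Nat.prime_two).mp (hp.dvd_of_dvd_pow h2); omega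
  · have := (Nat.prime_dvd_prime_iff_eq hp Nat.prime_three).mp (hp.dvd_of_dvd_pow h3); omega

/-- For coprime `u, w` and a prime `p ≥ 5` dividing `u w (u+w)(9u+w)`:
`p ∤ c₄ = 9u⁴+12u³w+30u²w²+12uw³+w⁴` (`c₄ ≡ w⁴ (mod u)`, `≡ 9u⁴ (mod w)`, `≡ 16u⁴ (mod u+w)`,
`≡ 144u⁴ (mod 9u+w)`). [folklore] -/
theorem not_dvd_c₄ {u w : ℤ} (huw : IsCoprime u w) {p : ℕ} (hp : p.Prime) (h5 : 5 ≤ p)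
    (h : (p : ℤ) ∣ u * w * (u + w) * (9 * u + w)) :
    ¬ (p : ℤ) ∣ (⟨w - u, -(u * (u + w)), -(u * w * (u + w)), 0, 0⟩ : WeierstrassCurve ℤ).c₄ := by
  rw [c₄_eq]
  intro hc
  have hpint : Prime (p : ℤ) := Nat.prime_iff_prime_int.mp hp
  have h144 := not_dvd_144 hp h5
  -- `p` cannot divide both `u` and `w`
  have key : ¬ ((p : ℤ) ∣ u ∧ (p : ℤ) ∣ w) := fun ⟨hu, hw⟩ =>
    hpint.not_unit (huw.isUnit_of_dvd' hu hw)
  -- `p ∣ 144 u⁴ ⇒ p ∣ u`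
  have hu4 : ∀ c : ℤ, c ∣ 144 → (p : ℤ) ∣ c * u ^ 4 → (p : ℤ) ∣ u := by
    intro c hc144 hcu
    rcases hpint.dvd_or_dvd hcu with h1 | h1
    · exact absurd (h1.trans hc144) h144
    · exact hpint.dvd_of_dvd_pow h1
  rcases hpint.dvd_or_dvd h with h₁ | h9
  · rcases hpint.dvd_or_dvd h₁ with h₂ | hs
    · rcases hpint.dvd_or_dvd h₂ with hu | hw
      · -- `p ∣ u`: `c₄ = u·(…) + w⁴`
        have h1 : (p : ℤ) ∣ 9 * u ^ 4 + 12 * u ^ 3 * w + 30 * u ^ 2 * w ^ 2 + 12 * u * w ^ 3 + w ^ 4 -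
            u * (9 * u ^ 3 + 12 * u ^ 2 * w + 30 * u * w ^ 2 + 12 * w ^ 3) :=
          dvd_sub hc (dvd_mul_of_dvd_left hu _)
        have h2 : 9 * u ^ 4 + 12 * u ^ 3 * w + 30 * u ^ 2 * w ^ 2 + 12 * u * w ^ 3 + w ^ 4 -
            u * (9 * u ^ 3 + 12 * u ^ 2 * w + 30 * u * w ^ 2 + 12 * w ^ 3) = w ^ 4 := by ring
        rw [h2] at h1
        exact key ⟨hu, hpint.dvd_of_dvd_pow h1⟩
      · -- `p ∣ w`: `c₄ = w·(…) + 9u⁴`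
        have h1 : (p : ℤ) ∣ 9 * u ^ 4 + 12 * u ^ 3 * w + 30 * u ^ 2 * w ^ 2 + 12 * u * w ^ 3 + w ^ 4 -
            w * (12 * u ^ 3 + 30 * u ^ 2 * w + 12 * u * w ^ 2 + w ^ 3) :=
          dvd_sub hc (dvd_mul_of_dvd_left hw _)
        have h2 : 9 * u ^ 4 + 12 * u ^ 3 * w + 30 * u ^ 2 * w ^ 2 + 12 * u * w ^ 3 + w ^ 4 -
            w * (12 * u ^ 3 + 30 * u ^ 2 * w + 12 * u * w ^ 2 + w ^ 3) = 9 * u ^ 4 := by ring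
        rw [h2] at h1
        exact key ⟨hu4 9 (by norm_num) h1, hw⟩
    · -- `p ∣ u + w`: `c₄ = (u+w)·(…) + 16u⁴`
      have h1 : (p : ℤ) ∣ 9 * u ^ 4 + 12 * u ^ 3 * w + 30 * u ^ 2 * w ^ 2 + 12 * u * w ^ 3 + w ^ 4 -
          (u + w) * (w ^ 3 + 11 * u * w ^ 2 + 19 * u ^ 2 * w - 7 * u ^ 3) :=
        dvd_sub hc (dvd_mul_of_dvd_left hs _)
      have h2 : 9 * u ^ 4 + 12 * u ^ 3 * w + 30 * u ^ 2 * w ^ 2 + 12 * u * w ^ 3 + w ^ 4 -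
          (u + w) * (w ^ 3 + 11 * u * w ^ 2 + 19 * u ^ 2 * w - 7 * u ^ 3) = 16 * u ^ 4 := by ring
      rw [h2] at h1
      have hu : (p : ℤ) ∣ u := hu4 16 (by norm_num) h1
      have hw : (p : ℤ) ∣ w := by
        have := dvd_sub hs hu; rwa [show u + w - u = w by ring] at this
      exact key ⟨hu, hw⟩
  · -- `p ∣ 9u + w`: `c₄ = (9u+w)·(…) + 144u⁴`
    have h1 : (p : ℤ) ∣ 9 * u ^ 4 + 12 * u ^ 3 * w + 30 * u ^ 2 * w ^ 2 + 12 * u * w ^ 3 + w ^ 4 -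
        (9 * u + w) * (w ^ 3 + 3 * u * w ^ 2 + 3 * u ^ 2 * w - 15 * u ^ 3) :=
      dvd_sub hc (dvd_mul_of_dvd_left h9 _)
    have h2 : 9 * u ^ 4 + 12 * u ^ 3 * w + 30 * u ^ 2 * w ^ 2 + 12 * u * w ^ 3 + w ^ 4 -
        (9 * u + w) * (w ^ 3 + 3 * u * w ^ 2 + 3 * u ^ 2 * w - 15 * u ^ 3) = 144 * u ^ 4 := by ring
    rw [h2] at h1
    have hu : (p : ℤ) ∣ u := hu4 144 dvd_rfl h1
    have hw : (p : ℤ) ∣ w := by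
      have := dvd_sub h9 (dvd_mul_of_dvd_right hu 9); rwa [show 9 * u + w - 9 * u = w by ring] at this
    exact key ⟨hu, hw⟩

/-- **Tate's algorithm away from `6` on the Kubert model** (Silverman AEC VII.5.1(b)): for coprime
`u, w` with the integral equation elliptic over `ℚ` and a prime `p ≥ 5` dividing
`u w (u+w)(9u+w)`, the equation is minimal at `p` with multiplicative reduction, so `f_p = 1` and
`p ∣ N` (dictionary item (D2); instrument DESK-PENCIL-6 P2: `v_p(N) = 1`, 0 exceptions).
[cite: SilvermanAEC2009, VII.5 Prop. 5.1(b)] -/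
theorem dvd_conductorNorm_of_prime {u w : ℤ} (huw : IsCoprime u w)
    [((⟨w - u, -(u * (u + w)), -(u * w * (u + w)), 0, 0⟩ : WeierstrassCurve ℤ).baseChange ℚ).IsElliptic]
    {p : ℕ} (hp : p.Prime) (h5 : 5 ≤ p) (h : (p : ℤ) ∣ u * w * (u + w) * (9 * u + w)) :
    p ∣ ((⟨w - u, -(u * (u + w)), -(u * w * (u + w)), 0, 0⟩ : WeierstrassCurve ℤ).baseChange ℚ).conductorNorm ℤ := by
  set W₀ : WeierstrassCurve ℤ := ⟨w - u, -(u * (u + w)), -(u * w * (u + w)), 0, 0⟩ with hW₀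
  obtain ⟨v, hv⟩ := exists_place ⟨p, hp⟩
  simp only at hv
  have hc₄ : ¬ (natGenerator v : ℤ) ∣ W₀.c₄ := by
    rw [hv]; exact not_dvd_c₄ huw hp h5 h
  have hΔ : (natGenerator v : ℤ) ∣ W₀.Δ := by
    rw [hv, hW₀, Δ_eq]
    exact h.trans (Dvd.intro (u ^ 5 * w * (u + w) ^ 2) (by ring))
  have hmin : (W₀.baseChange ℚ).IsMinimalAt v := isMinimalAt_baseChange_int_of_not_dvd_c₄ hc₄
  have hf : (W₀.baseChange ℚ).conductorExponent v = 1 :=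
    conductorExponent_eq_one_of_dvd_Δ_of_not_dvd_c₄ hmin hΔ hc₄
  have hfac := factorization_conductorNorm_holds (W₀.baseChange ℚ) v
  rw [hv, hf] at hfac
  have hN : (W₀.baseChange ℚ).conductorNorm ℤ ≠ 0 := (conductorNorm_pos_holds (W₀.baseChange ℚ)).ne'
  exact (hp.dvd_iff_one_le_factorization hN).mpr hfac.ge

/-- **The dictionary, conductor half**: for coprime `u, w` with `u w (u+w)(9u+w) ≠ 0` and the
Kubert equation elliptic over `ℚ`, `rad(u w (u+w)(9u+w)) ∣ 6 · N` (primes `p ≥ 5` by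
`dvd_conductorNorm_of_prime`, the primes `2, 3` by the factor `6`; instrument DESK-PENCIL-6 P2′).
[cite: SilvermanAEC2009, VII.5 Prop. 5.1(b)] -/
theorem radical_natAbs_dvd_six_mul_conductorNorm {u w : ℤ} (huw : IsCoprime u w)
    (h0 : u * w * (u + w) * (9 * u + w) ≠ 0)
    [((⟨w - u, -(u * (u + w)), -(u * w * (u + w)), 0, 0⟩ : WeierstrassCurve ℤ).baseChange ℚ).IsElliptic] :
    (radical (u * w * (u + w) * (9 * u + w))).natAbs ∣
      6 * ((⟨w - u, -(u * (u + w)), -(u * w * (u + w)), 0, 0⟩ : WeierstrassCurve ℤ).baseChange ℚ).conductorNorm ℤ := by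
  set m : ℤ := u * w * (u + w) * (9 * u + w) with hm
  have hm0 : m.natAbs ≠ 0 := Int.natAbs_ne_zero.mpr h0
  have hrad : (radical m).natAbs = radical m.natAbs := by
    rw [← Int.radical_natAbs_eq_radical, Int.natAbs_natCast]
  rw [hrad]
  have hN : ((⟨w - u, -(u * (u + w)), -(u * w * (u + w)), 0, 0⟩ : WeierstrassCurve ℤ).baseChange ℚ).conductorNorm ℤ ≠ 0 :=
    (conductorNorm_pos_holds _).ne'
  have h6N : 6 * ((⟨w - u, -(u * (u + w)), -(u * w * (u + w)), 0, 0⟩ : WeierstrassCurve ℤ).baseChange ℚ).conductorNorm ℤ ≠ 0 :=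
    mul_ne_zero (by norm_num) hN
  -- every prime of `m` divides `6 N`
  have key : ∀ p : ℕ, p.Prime → p ∣ m.natAbs →
      p ∣ 6 * ((⟨w - u, -(u * (u + w)), -(u * w * (u + w)), 0, 0⟩ : WeierstrassCurve ℤ).baseChange ℚ).conductorNorm ℤ := by
    intro p hp hpm
    by_cases hp2 : p = 2
    · subst hp2; exact dvd_mul_of_dvd_left (by norm_num) _
    by_cases hp3 : p = 3
    · subst hp3; exact dvd_mul_of_dvd_left (by norm_num) _
    have h5 : 5 ≤ p := by
      have h2 := hp.two_le
      by_contra hlt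
      interval_cases p <;> simp_all (config := {decide := true})
    exact dvd_mul_of_dvd_right (dvd_conductorNorm_of_prime huw hp h5 (Int.natCast_dvd.mpr hpm)) 6
  -- hence the radical (product of the distinct primes of `m`) divides `6 N`
  rw [← Nat.factorization_le_iff_dvd radical_ne_zero h6N]
  intro p
  by_cases hp : p.Prime
  · rw [factorization_radical_apply hm0 hp]
    split_ifs with hpn
    · exact (hp.dvd_iff_one_le_factorization h6N).mp (key p hp hpn)
    · exact Nat.zero_le _
  · simp [Nat.factorization_eq_zero_of_not_prime _ hp]

/-- **The dictionary, discriminant half**: `|Δ_min(W)| ≤ |u⁶ w² (u+w)³ (9u+w)|` as real numbers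
for the Kubert equation elliptic over `ℚ` (dictionary item (D1): the right-hand side is `|Δ|` of
the integral equation). [cite: SilvermanAEC2009, VII.1 Remark 1.1] -/
theorem cast_minimalDiscriminantNorm_le (u w : ℤ)
    [((⟨w - u, -(u * (u + w)), -(u * w * (u + w)), 0, 0⟩ : WeierstrassCurve ℤ).baseChange ℚ).IsElliptic] :
    ((((⟨w - u, -(u * (u + w)), -(u * w * (u + w)), 0, 0⟩ : WeierstrassCurve ℤ).baseChange ℚ).minimalDiscriminantNorm ℤ : ℕ) : ℝ) ≤
      |(((u ^ 6 * w ^ 2 * (u + w) ^ 3 * (9 * u + w) : ℤ)) : ℝ)| := by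
  set W₀ : WeierstrassCurve ℤ := ⟨w - u, -(u * (u + w)), -(u * w * (u + w)), 0, 0⟩ with hW₀
  have hΔ0 : W₀.Δ ≠ 0 := Δ_ne_zero_of_isElliptic_baseChange_int W₀
  -- `Δ_min ∣ Δ(W₀)` prime by prime (Silverman AEC VII.1 Remark 1.1)
  have hdvd : (W₀.baseChange ℚ).minimalDiscriminantNorm ℤ ∣ W₀.Δ.natAbs := by
    have hD0 : (W₀.baseChange ℚ).minimalDiscriminantNorm ℤ ≠ 0 :=
      (minimalDiscriminantNorm_pos_holds _).ne'
    rw [← Nat.factorization_le_iff_dvd hD0 (Int.natAbs_ne_zero.mpr hΔ0)]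
    intro p
    by_cases hp : p.Prime
    · obtain ⟨v, hv⟩ := exists_place ⟨p, hp⟩
      have hfac := factorization_minimalDiscriminantNorm_holds (W₀.baseChange ℚ) v
      obtain ⟨k, hk, -, -⟩ := exists_ordMinimalDiscriminant_add_eq_padicValInt v W₀
      haveI : Fact (natGenerator v).Prime := ⟨prime_natGenerator v⟩
      have hval : padicValInt (natGenerator v) W₀.Δ =
          W₀.Δ.natAbs.factorization (natGenerator v) := by
        rw [padicValInt, Nat.factorization_def _ (prime_natGenerator v)]
      simp only at hv
      rw [← hv, hfac, ← hval]
      omega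
    · simp [Nat.factorization_eq_zero_of_not_prime _ hp]
  have h1 : (W₀.baseChange ℚ).minimalDiscriminantNorm ℤ ≤ W₀.Δ.natAbs :=
    Nat.le_of_dvd (Int.natAbs_pos.mpr hΔ0) hdvd
  have h2 : ((W₀.Δ.natAbs : ℕ) : ℝ) = |(((u ^ 6 * w ^ 2 * (u + w) ^ 3 * (9 * u + w) : ℤ)) : ℝ)| := by
    rw [Nat.cast_natAbs, Int.cast_abs, hW₀, Δ_eq]
  rw [← h2]
  exact_mod_cast h1

/-- **The six-torsion dictionary** (unfolded form of the route decl): for coprime `u, w` with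
`u w (u+w)(9u+w) ≠ 0` and every elliptic `W = ⟨w−u, −u(u+w), −uw(u+w), 0, 0⟩ / ℚ`,
`|Δ_min(W)| ≤ |u⁶ w² (u+w)³ (9u+w)|` and `rad(u w (u+w)(9u+w)) ∣ 6 · N_W`.
[cite: SilvermanAEC2009, VII.1 Remark 1.1 and VII.5 Prop. 5.1(b)] -/
theorem sixTorsionDictionary (u w : ℤ) (huw : IsCoprime u w)
    (h0 : u * w * (u + w) * (9 * u + w) ≠ 0) (W : WeierstrassCurve ℚ) [W.IsElliptic]
    (hW : W = ⟨((w - u : ℤ) : ℚ), ((-(u * (u + w)) : ℤ) : ℚ), ((-(u * w * (u + w)) : ℤ) : ℚ), 0, 0⟩) :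
    (W.minimalDiscriminantNorm ℤ : ℝ) ≤ |(((u ^ 6 * w ^ 2 * (u + w) ^ 3 * (9 * u + w) : ℤ)) : ℝ)| ∧
      (radical (u * w * (u + w) * (9 * u + w))).natAbs ∣ 6 * W.conductorNorm ℤ := by
  have hW' : W = (⟨w - u, -(u * (u + w)), -(u * w * (u + w)), 0, 0⟩ : WeierstrassCurve ℤ).baseChange ℚ :=
    hW.trans (baseChange_eq u w).symm
  subst hW'
  exact ⟨cast_minimalDiscriminantNorm_le u w, radical_natAbs_dvd_six_mul_conductorNorm huw h0⟩

end SixTorsionDictionary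

/-- **Closes stmt-ABC-24551 `SixTorsionDictionary` of route `RationalCuspPencil`**: Tate's
algorithm away from `6` on Kubert's ℤ/6 model — `|Δ_min(W)| ≤ |u⁶w²(u+w)³(9u+w)|` and
`rad(uw(u+w)(9u+w)) ∣ 6·N_W` for coprime `u, w`. Library bookkeeping on a torsion class; NOT abc,
NOT A-PS, moves no rung. [cite: SilvermanAEC2009, VII.1 Remark 1.1 and VII.5 Prop. 5.1(b)] -/
theorem sixTorsionDictionary_proof :
    Summit.ABC.ABC.Theses.RationalCuspPencil.SixTorsionDictionary := by
  unfold Summit.ABC.ABC.Theses.RationalCuspPencil.SixTorsionDictionary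
  intro u w huw h0 W _ hW
  exact SixTorsionDictionary.sixTorsionDictionary u w huw h0 W hW

end Summit.ABC.ABC.Theorems
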